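/-
Copyright (c) 2026. All rights reserved.
Released under Apache 2.0 license as described in the file LICENSE.
Authors: abc-iut cell, campaign-S prover seat abc-iut-S8 (wave 2).
-/
import Literature.IUT.LogVolume.LogVolumeEstimates
import HarnessLib

/-!
# [IUTchIV] Prop. 1.4 as used in Thm. 1.10, Steps (v)–(vi): bounds for subsets of the packet modules

Mochizuki, *Inter-universal Teichmüller theory IV*, RIMS manuscript (Apr. 2020), proof of Thm. 1.10.
Step (v) (kurims p. 28): "an upper bound on the component of the log-volume of the holomorphic hull
under consideration may be obtained by computing an upper bound for the log-volume of the right-hand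
side of the inclusion `p^{⌊λ−d_I−a_I⌋}·log_p(R_I^×) ⊆ p^{⌊λ−d_I−a_I⌋−b_I}·(R_I)^∼` of Proposition 1.4,
(iii)".  Step (vi) (p. 29): "the inclusion "`φ((R_I)^∼) ⊆ (R_I)^∼`" of Proposition 1.4, (iv), implies that
the tensor product of log-shells under consideration contains the "union of possible images of a
Θ-pilot object" … Thus, an upper bound on the component of the log-volume … may be obtained by computing
an upper bound for the log-volume of … `(R_I)^∼`", i.e. `≤ μ^log((R_I)^∼) = 0`.

THEOREMS ONLY, over `LogVolumeEstimates.lean` (abc-iut-S8): the Step (v) form is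
`packetLogVolume_le_of_subset_translate` there; here
* `packetLogVolume_nonpos_of_subset_normalizedPacket` — the Step (vi) form: a subset `U ⊆ (R_I)^∼` of
  positive volume has `μ^log(U) ≤ 0`;
* the same two bounds stated for subsets of `⊕_j L_j` lying in the IMAGES under the decomposition `ψ`
  (`normalizedLogVolume_le_of_subset_image_translate`, `normalizedLogVolume_nonpos_of_subset_polydisc`),
  which is the form in which holomorphic hulls (`HolomorphicHull.lean`, abc-iut-S2: subsets of
  `⊕_j L_j`) are measured.
No Θ-pilot object, log-shell or indeterminacy is mentioned here: those live in [IUTchIII] and enter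
only through the hypothesis "`U ⊆` the module".  Nothing here bears on the disputed [IUTchIII] Cor. 3.12.
-/

noncomputable section

open MeasureTheory Set Metric Finset
open scoped NormedField Pointwise ENNReal

namespace Literature.IUT.LogVolume

variable (p : ℕ) [Fact p.Prime]
variable {I : Type} [Fintype I] [DecidableEq I]
variable (k : I → Type) [∀ i, NontriviallyNormedField (k i)] [∀ i, NormedAlgebra ℚ_[p] (k i)]
  [∀ i, IsUltrametricDist (k i)] [∀ i, ProperSpace (k i)]
variable {J : Type} [Fintype J] (L : J → Type) [∀ j, NontriviallyNormedField (L j)]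
  [∀ j, NormedAlgebra ℚ_[p] (L j)] [∀ j, IsUltrametricDist (L j)] [∀ j, ProperSpace (L j)]
  [∀ j, MeasurableSpace (L j)] [∀ j, BorelSpace (L j)]
variable (ψ : PacketAlgebra p k ≃ₐ[ℚ_[p]] (Π j, L j))

/-! ## Step (vi): subsets of `(R_I)^∼` -/

/-- `ψ((R_I)^∼) = ∏ O_{L_j}` has volume `1`. [cite: Mochizuki2012, IUTchIV Prop. 1.4 (i) p. 13] -/
theorem haar_image_normalizedPacket (hI : 2 ≤ Fintype.card I) :
    (piUnitBallStructure L).haar (ψ '' (normalizedPacket p k : Set (PacketAlgebra p k))) = 1 := by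
  haveI : Nonempty I := Fintype.card_pos_iff.mp (by omega)
  rw [image_normalizedPacket p k L ψ, ← coe_piUnitBallStructure]
  exact (piUnitBallStructure L).haar_self

/-- **Step (vi) form of Prop. 1.4 (iv)**: every subset `U ⊆ (R_I)^∼` of positive volume has
`μ^log(U) ≤ μ^log((R_I)^∼) = 0` (Thm. 1.10, proof, Step (vi), p. 29).
[cite: Mochizuki2012, IUTchIV Thm. 1.10 proof Step (vi) p. 29] -/
theorem packetLogVolume_nonpos_of_subset_normalizedPacket (hI : 2 ≤ Fintype.card I)
    {U : Set (PacketAlgebra p k)} (hU : U ⊆ normalizedPacket p k)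
    (hUpos : 0 < (piUnitBallStructure L).haar (ψ '' U)) :
    packetLogVolume p k L ψ U ≤ 0 := by
  have hB : (piUnitBallStructure L).haar (ψ '' (normalizedPacket p k : Set (PacketAlgebra p k))) < ⊤ := by
    rw [haar_image_normalizedPacket p k L ψ hI]; exact ENNReal.one_lt_top
  exact (packetLogVolume_mono p k L ψ hUpos hB hU).trans (prop14iv_volume p k L ψ hI).le

/-! ## The same bounds for subsets of `⊕_j L_j` inside the images -/

omit [Fintype I] [DecidableEq I] [∀ i, IsUltrametricDist (k i)] [∀ i, ProperSpace (k i)] in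
/-- For `S ⊆ ⊕_j L_j`: `μ^log(ψ⁻¹ S) = (1/D)·log μ(S)` (the decomposition log-volume of the preimage).
[cite: Mochizuki2012, IUTchIV Prop. 1.4 (i) p. 13] -/
theorem packetLogVolume_preimage (S : Set (Π j, L j)) :
    packetLogVolume p k L ψ (ψ ⁻¹' S)
      = (piUnitBallStructure L).normalizedLogVolume (packetDegree p L) S := by
  rw [packetLogVolume_def, Set.image_preimage_eq S ψ.surjective]

/-- **Step (v), measured in `⊕_j L_j`**: a subset `S` of positive volume of the image
`ψ(p^{⌊λ−d_I−a_I⌋−b_I}·(R_I)^∼)` (a hull set `∏_j c_j·O_{L_j}`) has degree-normalised log-volume at most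
`{−λ + d_I + 1}·log(p) + Σ_{i∈I*}{3 + log(e_i)}` — the form consumed by holomorphic hulls of subsets of
the image. [cite: Mochizuki2012, IUTchIV Thm. 1.10 proof Step (v) p. 28] -/
theorem normalizedLogVolume_le_of_subset_image_translate (hI : 2 ≤ Fintype.card I)
    (Istar : Finset I) (htame : ∀ i, i ∉ Istar → absRamificationIdx p (k i) ≤ p - 2)
    (i : I) (m : ℤ) (h : Π i, k i) (hh : RealizesNegB p k h) {S : Set (Π j, L j)}
    (hS : S ⊆ ψ '' ((ppow p k ⌊(m : ℝ) / absRamificationIdx p (k i) - dSum p k - aSum p k⌋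
        * purePacket p k h) • (normalizedPacket p k : Set (PacketAlgebra p k))))
    (hSpos : 0 < (piUnitBallStructure L).haar S) :
    (piUnitBallStructure L).normalizedLogVolume (packetDegree p L) S
      ≤ (-((m : ℝ) / absRamificationIdx p (k i)) + dSum p k + 1) * Real.log p
          + ∑ i ∈ Istar, (3 + Real.log (absRamificationIdx p (k i))) := by
  rw [← packetLogVolume_preimage p k L ψ S]
  refine packetLogVolume_le_of_subset_translate p k L ψ hI Istar htame i m h hh ?_ ?_
  · intro x hx
    obtain ⟨y, hy, hyx⟩ := hS hx
    rwa [← ψ.injective hyx]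
  · rwa [Set.image_preimage_eq S ψ.surjective]

omit [Fintype I] [DecidableEq I] [∀ i, IsUltrametricDist (k i)] [∀ i, ProperSpace (k i)] in
/-- **Step (vi), measured in `⊕_j L_j`**: a subset `S ⊆ ∏_j O_{L_j}` (`= ψ((R_I)^∼)`) of positive volume
has `(1/D)·log μ(S) ≤ 0` (monotonicity and `μ(∏ O_{L_j}) = 1`; no decomposition is needed for this
form). [cite: Mochizuki2012, IUTchIV Thm. 1.10 proof Step (vi) p. 29] -/
theorem normalizedLogVolume_nonpos_of_subset_polydisc (D : ℕ)
    {S : Set (Π j, L j)} (hS : S ⊆ polydisc L (fun _ ↦ 1)) (hSpos : 0 < (piUnitBallStructure L).haar S) :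
    (piUnitBallStructure L).normalizedLogVolume D S ≤ 0 := by
  have hB : (piUnitBallStructure L).haar (polydisc L (fun _ ↦ 1)) < ⊤ := by
    rw [← coe_piUnitBallStructure, (piUnitBallStructure L).haar_self]; exact ENNReal.one_lt_top
  have h := (piUnitBallStructure L).normalizedLogVolume_mono D hSpos hB hS
  rw [← coe_piUnitBallStructure, (piUnitBallStructure L).normalizedLogVolume_self] at h
  exact h

end Literature.IUT.LogVolume

end
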